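import Summits.BirchSwinnertonDyer.BirchSwinnertonDyer.Theorems.ErratumRoadFiveNonSurjCornerHybridResidualDefs
import HarnessLib

/-!
# Route `ErratumRoadFive` (rung K2), crux `NonSurjCorner` (item stmt-BirchSwinnertonDyer-19065), gen-3 child 23047 `NonSurjCornerTwinMuAnDeep`:
# THE PER-PAIR UNIT OF THE μ-SLOT — «ONE Friedberg–Hoffstein twin per DEEP corner pair» as a `Prop` constant, and the bookkeeping that it
# (with 23046 and the route items) still gives the crux
# (cell `bsd-stepL`, WIDTH-LEVER lane B `bsd-stepL-corner5-p2` g18; `--supports stmt-BirchSwinnertonDyer-23047`)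

WHY THIS FILE. Item 23047 (`Theorems.NonSurjCornerTwinMuAnDeep`) asks analytic μ = 0 at EVERY Friedberg–Hoffstein twin `E^{(d_K)}` of every deep
corner pair — infinitely many twins PER PAIR — while the crux's cone consumes μ = 0 at ONE twin per pair: the field of the deep witness
(`Theorems.NonSurjCornerDeepWitnessResidual`, corner-p1 g20; chosen there by Friedberg–Hoffstein). Lane B's kernel certificates (μ symbol tables,
`…TwinMuAnTables*`) are produced one twin at a time, and the director's compute ruling (ladder-directors/REQUESTS 2026-08-30 (489)∕(490)) asks for
«the finite closing instance list for 23047» — which cannot exist for a `∀ K` statement. This file types the honest per-pair unit BY NAME: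
* §1 **`NonSurjCornerTwinMuAnDeepOneTwin`** — at every DEEP corner pair (`ClassX11b`, `ρ̄` not onto, `p ∈ {5,7}`, `p ∣ ord_p Δ_min`, no (ram) witness,
  `0 < ord_p #Ш(E)_an`) SOME imaginary quadratic `K` (`|d_K| > 4`, Heegner for `N_E`, `L(E^{(d_K)},1) ≠ 0`) at whose twist `E^{(d_K)}` the μ-clause of 23047
  holds (every globally minimal model, newform, period ratio, allowable root). One certified twin per pair discharges its instance (modulo the table
  claim `MuTable.ClaimFor` and the doors' named facts, as for 23047).
* §2 `twinMuAnDeepOneTwin_of_twinMuAnDeep` — 23047 implies it (Friedberg–Hoffstein Thm. B chooses the field; modularity gives the sign).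
* §3 `deepWitnessResidual_of_kolyZDeep_of_twinMuAnDeepOneTwin` — 23046 ∧ §1 ⟹ residue 1 (Mazur's Manin-good datum at THAT field,
  `X11b.exists_maninDatum`; the Heegner hypothesis at `p` is inherited from `p ∣ N_E`). So the two research halves stay SEPARATE items (lane A:
  certificates at every deep frame; lane B: μ = 0 at one twin per pair) and still meet in the ∃-residue.
* §4 `nonSurjCorner_of_kolyZDeep_of_twinMuAnDeepOneTwin_of_items` — the crux from 23046, §1, 23048, 19064, 19066, 27981, 19524, 19716 and the
  Irr aside: the binder list of the registered `Lines/hybrid.lean` r26 `NonSurjCorner_of` with 23047 REPLACED by §1 (a turnkey for a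
  planner re-cut; registering is the planner's call, D-0145).

HONEST FRAMING: one `Prop` constant (OPEN, ∃-shaped weakening of item 23047; tagged `@[conjecture]`), three bookkeeping theorems (no `sorry`, no new
named fact); NOTHING is asserted about any curve; items 19065 ∕ 23046 ∕ 23047 stay open; no census word, tier or label moves (T7); BSD is proved for no
curve. Even §1 ranges over an infinite class (24 deep pairs known: 22 at `p = 5`, 2 at `p = 7`; no completeness theorem at any conductor bound), so it
has no finite closing instance list either; per pair it is ONE computation.
References (locators only): [FriedbergHoffstein1995] Thm. B; [Mazur1978] Cor. 4.1; [GreenbergLNM1716] §1 Conj. 1.11 (p. 61), §5 Conj. 5.12 (odd twists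
may change μ — why no transfer between the twins of one pair is claimed); [EmertonPollackWeston2006] Thm. 1 (μ = 0 is constant on `𝓗(ρ̄)`; the twins of
one pair have different `ρ̄ ⊗ χ_d`); [Cha2005] Thm. 21, Rmk. 25; [Miller2011LMS] Def. 1.1.
-/

set_option autoImplicit false
set_option linter.dupNamespace false -- `Summit.BirchSwinnertonDyer.BirchSwinnertonDyer` (summit = problem), tree-wide

noncomputable section

open scoped Classical NumberField MatrixGroups ModularForm

namespace Summit.BirchSwinnertonDyer.BirchSwinnertonDyer.Theorems

open CongruenceSubgroup WeierstrassCurve NumberField IsDedekindDomain Field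
  Literature.NumberTheory.EllipticCurves
  Literature.NumberTheory.EllipticCurves.ModularForms
  Literature.NumberTheory.Automorphic
  Literature.NumberTheory.EllipticCurves.Rank1Residual
  Literature.NumberTheory.EllipticCurves.Rank1Residual.Typed
  Summit.BirchSwinnertonDyer.Rank1Residual
  Summit.BirchSwinnertonDyer.Rank1Residual.X11b
  Summit.BirchSwinnertonDyer.Rank1Residual.X11b.Three.Koly

/-! ### §1 The per-pair unit of the μ-slot (OPEN; nothing asserted) -/

/-- [weakening of crux child 23047 `NonSurjCornerTwinMuAnDeep` of item 19065 `NonSurjCorner`] **Analytic μ = 0 at ONE Friedberg–Hoffstein twin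
per DEEP corner pair.** For every corner pair `(E,p)` (`ClassX11b`, `ρ̄_{E,p}` not onto, `p ∈ {5,7}`, `p ∣ ord_p Δ_min`, no (ram) witness) with
`#Ш(E)_an = s`, `0 < ord_p s`: SOME imaginary quadratic `K` with `|d_K| > 4`, the Heegner hypothesis for `N_E` and `L(E^{(d_K)},1) ≠ 0`, such that
at every globally minimal model `Wd = Cd • E^{(d_K)}` that is a non-surjective X11a leaf at `p` with `p ∣ ord_p Δ_min(Wd)`, for every newform `f`
of `Wd`, period ratio `ϖ` (`ϖ·Ω_{Wd} = Ω⁺_f`) and Mazur–Tate–Teitelbaum function `L` of `f` at `p` with allowable root `a = ±1`, SOME coefficient of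
`ϖ·L` is a `p`-adic unit. Item 23047 asks the same at EVERY such `K` and implies this (`twinMuAnDeepOneTwin_of_twinMuAnDeep`); the crux needs only
this (`nonSurjCorner_of_kolyZDeep_of_twinMuAnDeepOneTwin_of_items`). OPEN class-wide (Greenberg's Conj. 1.11 at a non-surjective irreducible image);
per pair ONE computation (lane B's μ symbol tables). A `Prop` constant; nothing asserted.
[cite: GreenbergLNM1716, §1 Conj. 1.11 (p. 61) (shape)] [cite: FriedbergHoffstein1995, Thm. B (the field exists)] [cite: Kato2004Asterisque, Thm. 12.4 (the consumer)] -/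
@[conjecture]
def NonSurjCornerTwinMuAnDeepOneTwin : Prop :=
  ∀ (W : WeierstrassCurve ℚ) [W.IsElliptic] [W.IsGloballyMinimal] (p : ℕ) [Fact p.Prime],
    ClassX11b W p → ¬ Surj W p → (p = 5 ∨ p = 7) → p ∣ padicValInt p W.minimalDiscriminantInt →
    ¬ Ram W p → (∃ s : ℚ, shaAn W = (s : ℂ) ∧ 0 < padicValRat p s) →
    ∃ (K : Type) (_ : Field K) (_ : NumberField K),
      IsImaginaryQuadratic K ∧ 4 < (NumberField.discr K).natAbs ∧
      SatisfiesHeegnerHypothesis (W.conductorNorm ℤ) K ∧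
      (W.quadraticTwist (NumberField.discr K : ℚ)).entireLFunction 1 ≠ 0 ∧
      ∀ (Wd : WeierstrassCurve ℚ) [Wd.IsElliptic] [Wd.IsGloballyMinimal] (Cd : VariableChange ℚ),
        Cd • W.quadraticTwist (NumberField.discr K : ℚ) = Wd →
        ClassX11a Wd p → ¬ Surj Wd p → p ∣ padicValInt p Wd.minimalDiscriminantInt →
        ∀ {N : ℕ} [NeZero N] (f : CuspForm (Gamma0 N) 2), IsNewformOf Wd f →
        ∀ (ϖ : ℚ), (ϖ : ℝ) * Wd.realPeriodRat = plusPeriod f →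
        ∀ (a : ℚ_[p]) (L : PowerSeries ℚ_[p]),
          (Wd.HasSplitMultiplicativeReductionAtPrime p → a = 1) →
          (¬ Wd.HasSplitMultiplicativeReductionAtPrime p → a = -1) →
          IsMultPAdicLFunctionOf f p a L →
          ∃ n : ℕ, ‖PowerSeries.coeff n (PowerSeries.C ((ϖ : ℚ) : ℚ_[p]) * L)‖ = 1

/-! ### §2 Item 23047 implies the per-pair unit -/

/-- **23047 ⟹ one twin per pair**: given modularity (`exists_isNewformOf`, for the sign `w(E) = −1` at analytic rank one) and the one-prime
Friedberg–Hoffstein fact (a Heegner field with `|d_K| > 4`, `p` split, `L(E^{(d_K)},1) ≠ 0`) — conjuncts 5 and 6 of item 23048 — the `∀ K` child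
23047 gives the μ-clause at the field so chosen. Bookkeeping; nothing asserted about any curve. [cite: FriedbergHoffstein1995, Thm. B] -/
theorem twinMuAnDeepOneTwin_of_twinMuAnDeep (hnf : exists_isNewformOf)
    (hFHs : friedbergHoffstein_exists_heegnerField_split_twist_ne_zero)
    (hμ : Summit.BirchSwinnertonDyer.BirchSwinnertonDyer.Theses.ErratumRoadFive.NonSurjCornerTwinMuAnDeep) :
    NonSurjCornerTwinMuAnDeepOneTwin := by
  intro W _ _ p _ hX hns h57 hv hnr hspos
  have hp : p.Prime := Fact.out
  have hw : W.rootNumber = -1 := by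
    rw [WeierstrassCurve.rootNumber_eq_neg_one_pow_analyticRank_of_exists_isNewformOf hnf W, hX.1]
    norm_num
  obtain ⟨K, _, _, hK, hdisc, hHN, -, hLt⟩ := hFHs W hw p hp 4
  exact ⟨K, inferInstance, inferInstance, hK, hdisc, hHN, hLt,
    fun Wd _ _ Cd hWd hXa hnsd hvd N _ f hf ϖ hϖ a L hsa hna hL ↦
      hμ W p hX hns h57 hv hnr hspos K Wd Cd hK hHN hLt hWd hXa hnsd hvd f hf ϖ hϖ a L hsa hna hL⟩

/-! ### §3 23046 ∧ (one twin per pair) imply residue 1 -/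

/-- **The DEEP Kolyvagin child and ONE certified twin per deep pair give the deep witness.** From 23046 (`NonSurjCornerKolyZDeep`: refined-Kolyvagin
certificates at EVERY deep frame) and §1 (μ = 0 at ONE Friedberg–Hoffstein field `K` per deep pair), with modularity and Mazur 1978 Cor. 4.1
(`X11b.exists_maninDatum`: a Manin-good datum `p ∤ c`, a Heegner datum of discriminant `d_K`, an embedding and the `K`-rational Heegner point) at THAT
field: residue 1 `NonSurjCornerDeepWitnessResidual`. The Heegner hypothesis at `p` needed by 23046 is inherited from the one at `N_E` since `p ∣ N_E`
(multiplicative reduction). Bookkeeping; nothing asserted about any curve. [cite: Mazur1978, Cor. 4.1] [cite: Darmon2004, Thm. 3.6 and Hypothesis 3.9] -/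
theorem deepWitnessResidual_of_kolyZDeep_of_twinMuAnDeepOneTwin (hnf : exists_isNewformOf)
    (hMaz : mazur_not_dvd_maninConstant_of_odd)
    (hZ : Summit.BirchSwinnertonDyer.BirchSwinnertonDyer.Theses.ErratumRoadFive.NonSurjCornerKolyZDeep)
    (hμ1 : NonSurjCornerTwinMuAnDeepOneTwin) :
    NonSurjCornerDeepWitnessResidual := by
  intro W _ _ p _ hX hns h57 hv hnr hspos
  have hNS : integral_neronScaling_of_isGloballyMinimal := integral_neronScaling_of_isGloballyMinimal_holds
  have hp5 : 5 ≤ p := by rcases h57 with h | h <;> omega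
  obtain ⟨-, -, hmult, hirr⟩ := id hX
  haveI : NeZero (W.conductorNorm ℤ) := ⟨(W.conductorNorm_pos_holds).ne'⟩
  obtain ⟨K, _, _, hK, hdisc, hHN, hLt, hμK⟩ := hμ1 W p hX hns h57 hv hnr hspos
  have hHp : SatisfiesHeegnerHypothesis p K :=
    SatisfiesHeegnerHypothesis.of_dvd (dvd_conductorNorm_of_mult hmult) hHN
  obtain ⟨Dt, H, ι, P, hP, hc⟩ :=
    exists_maninDatum hnf hMaz hNS W p (W.conductorNorm ℤ) K rfl hp5 hmult hirr hK hHN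
  refine ⟨W.conductorNorm ℤ, inferInstance, K, inferInstance, inferInstance, Dt, H, ι, P, rfl, hK, hdisc, hHN, hLt, hP, hc,
    fun hdeep ↦ ?_, fun Wd _ _ Cd hWd hXa hnsd hvd N _ f hf ϖ hϖ a L hsa hna hL ↦
      hμK Wd Cd hWd hXa hnsd hvd f hf ϖ hϖ a L hsa hna hL⟩
  exact hZ W p (W.conductorNorm ℤ) K Dt H.β ι hX hns h57 hv hnr hspos rfl hK hdisc hHN hHp H.dvd_sq_sub hc hdeep

/-! ### §4 The crux from 23046, the per-pair unit, and the route items (r26's binder list with 23047 replaced) -/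

/-- **`NonSurjCorner` from 23046, ONE certified twin per deep pair, and the route items BY NAME** — the binders of the registered zero-stub
composition `Cruxes/NonSurjCorner/Lines/hybrid.lean` r26 `NonSurjCorner_of` with the `∀ K` child 23047 REPLACED by §1: 23046 `NonSurjCornerKolyZDeep`,
§1, 23048 `KatoTwinFactsFiveAnContra`, 19064 `X11aLowerHalf`, 19066 `PublishedInputsFive`, 27981 `EulerHalfGrossPrintFacts`, 19524
`ShimuraParametrizationDataNonempty`, 19716 `PastenComponentOrdersInput`, and the aside `ShimuraHeegnerEulerSystemInertPrintedIrr` (definitionally the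
Irr-primitives name `shimuraCurve_heegnerSystem_primitivesFromFiveIrr`) — EXACTLY r26's binder types except the second. Proof: §3 and corner-p1 g20's `twinLowerSupplyResidual_of_x11aLowerHalf` feed
`nonSurjCorner_of_residuals_of_items`. CONDITIONAL on every binder; 19065 NOT closed by this file; registering a re-cut is the planner's call; T7.
[cite: Cha2005, Thm. 21 and Rmk. 25] [cite: Miller2011LMS, Def. 1.1] [cite: Mazur1978, Cor. 4.1] -/
theorem nonSurjCorner_of_kolyZDeep_of_twinMuAnDeepOneTwin_of_items
    (hZ : Summit.BirchSwinnertonDyer.BirchSwinnertonDyer.Theses.ErratumRoadFive.NonSurjCornerKolyZDeep)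
    (hμ1 : NonSurjCornerTwinMuAnDeepOneTwin)
    (hF : Summit.BirchSwinnertonDyer.BirchSwinnertonDyer.Theses.ErratumRoadFive.KatoTwinFactsFiveAnContra)
    (h₃ : Summit.BirchSwinnertonDyer.BirchSwinnertonDyer.Theses.ErratumRoadFive.X11aLowerHalf)
    (h₅ : Summit.BirchSwinnertonDyer.BirchSwinnertonDyer.Theses.ErratumRoadFive.PublishedInputsFive)
    (hGr : Summit.BirchSwinnertonDyer.BirchSwinnertonDyer.Theses.ErratumRoadFive.EulerHalfGrossPrintFacts)
    (hJL : Summit.BirchSwinnertonDyer.BirchSwinnertonDyer.Theses.ErratumRoadFive.ShimuraParametrizationDataNonempty)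
    (hCO : Summit.BirchSwinnertonDyer.BirchSwinnertonDyer.Theses.ErratumRoadFive.PastenComponentOrdersInput)
    (hPrim : Summit.BirchSwinnertonDyer.BirchSwinnertonDyer.Theses.ErratumRoadFive.ShimuraHeegnerEulerSystemInertPrintedIrr) :
    Summit.BirchSwinnertonDyer.BirchSwinnertonDyer.Theses.ErratumRoadFive.NonSurjCorner := by
  obtain ⟨-, -, -, -, hnf, -, hMaz, -⟩ := id hF
  exact nonSurjCorner_of_residuals_of_items (deepWitnessResidual_of_kolyZDeep_of_twinMuAnDeepOneTwin hnf hMaz hZ hμ1)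
    (twinLowerSupplyResidual_of_x11aLowerHalf hF h₅ h₃) hF h₅ hGr hJL hCO hPrim

end Summit.BirchSwinnertonDyer.BirchSwinnertonDyer.Theorems

end
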